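/-
Copyright (c) 2026 the pub-hodgecm-mathlib formalisation cell (harness21).  Prover seat hodgecm-mathlib-LH4-p04 (g8), req620 Track A «(D-RAM) FOUR-FRAME» squad
(STAGE-1b, row (2) of the piece `f_{T₊}`, the (β₂) road; dealer∕pen LH4-plan (g13) WORD #108 (4) ∕ WORD #112 (1): «(S4) β₂ ASSEMBLY», LH4-p04 lineage; brick (S4-frame)), 2026-09-04.
-/
import Summits.HodgeConjecture.HodgeConjecture.Theorems.F0P3cDyRamLevelsTypeTwoCensusLawOfSockets   -- ★ (LH4-p06 (g7)) FILE C of the (LAW) END: the frame-package construction transplanted here (★ `exists_eigenPackage`, ★ (QM) quadratic completion letters, ★ `exists_isSquare_inv_mul_coe_of_ne_zero`)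
import Summits.HodgeConjecture.HodgeConjecture.Theorems.F0P3cDyRamStageOneBDefs                  -- ★ DEFS №5: `cleanMinusFixCount`, `mcOfRecord`; brings ★ U2G `transvPlusFixCount`, ★ №3 `mstarOfRecord`
import HarnessLib

/-!
# Crux `H413`, line LH4 «(D-RAM) FOUR-FRAME» — STAGE-1b, row (2), the (β₂) road, brick (S4-frame): «β₂ AT THE LITERALS ⟸ β₂ AT THE LITERALS GIVEN THE EIGEN-FIELD PACKAGE»
# `betaT2lit.letter.v1` (ecb8685d) ⟸ `beta2Frame.letter.v1`: the same literal identity, with the FRAME PACKAGE `(E′, c₁, δ, m₀, s, w₁, Θ, α, lam)` + its 18 letters SUPPLIED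

Cell `hodgecm-mathlib` (D-0151), FLOOR 0, crux item H413 = `stmt-HodgeConjecture-24833`, route of record `HCCMUnconditional`; squad F0∕P3c∕LH4; lane
`--supports stmt-HodgeConjecture-24833 --as helper` (count-neutral; pays NO tier-0 row).  THEOREMS ONLY (one theorem; no `def`, no instance, no notation, no `sorry`).

WHY.  After ★ p860931 `hbeta2_of_literals` the (β₂) letter of the T₊ row is `betaT2lit.letter.v1` (ecb8685d): an identity between the labelled fixed-vertex counts `T₊ − T−′` of
the two literal shapes `endoGL (ι_w γ_H.1, ι_w γ_H.2)` and `P₁·endoGL (γ₁, ι_w γ_H.2)·P₁⁻¹`.  Every tool that evaluates such counts — ★ (C1) ∕ ★ p861044 ∕ ★-cand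
`…WSideOrderCensusLabelled` (the labelled order forms, this seat), the T5s tables, the (β₂-S)∕(β₂-H) engines — lives on the LINE MODEL over the EIGEN-FIELD `M = E′_{w₁}` of the
w-block (`E′ = L(√m₀)`, `m₀` the square class of `tr² − 4·det`), i.e. needs the FRAME PACKAGE `(E′, c₁, δ, m₀, s, w₁, Θ, α, lam)` with its 18 letters (★ p857432
`exists_eigenPackage`).  The (LAW) END solved the same logistics once: ★ FILE C `…LevelsTypeTwoCensusLawOfSockets.levels_typeTwo_censusLaw_of_levelsCensus4` builds the package
per `γ_H` and feeds the frame-level socket `levelsCensus4`.  THIS FILE is the (β₂) twin of that step — **`hbeta2lit_of_frame (hFrame : ‹beta2Frame.letter.v1›) : ‹betaT2lit.letter.v1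
VERBATIM›`** — where `beta2Frame.letter.v1` (text `F0/P3c/LH4/LH4-p04/g8/beta2Frame.letter.v1.LH4p04g8.lean.txt`) = `betaT2lit`'s place prefix and `∃ V ∀ γ_H` head, then
`levelsCensus4`'s frame-package block (`∀ (E′ c₁ δ m₀ s w₁ hw₁ Θ α lam)` + 18 letters, CHARACTER FOR CHARACTER), then `betaT2lit`'s literal block (`∀ (P₁ dg η γ₁)` + 10 clauses)
and conclusion.  Proof = FILE C's frame construction, token for token (`m₀` by ★ `exists_isSquare_inv_mul_coe_of_ne_zero`, `E′ = AdjoinRoot (X² − C m₀)` by ★ (QM), the package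
by ★ `exists_eigenPackage`), then `hFrame` at the package.  So the (β₂) producer now receives the eigen-field package for free, in the letters the levels lane already speaks.
`hFrame` is a HYPOTHESIS — nothing asserted.
HONEST LABEL.  Count-neutral logistics; (β₂) ∕ `betaT2lit` ∕ `beta2Frame` are HYPOTHESES of the T₊ chain; `HC_CM` is proved only modulo the 7 printed citations (2 remaining named
inputs: hLiu418 = `stmt-HodgeConjecture-24832`, h413 = `stmt-HodgeConjecture-24833`) until rung 0 closes.
## References
* [Rogawski1990] J. D. Rogawski, *Automorphic Representations of Unitary Groups in Three Variables*, Ann. of Math. Stud. 123 (1990): §4.9 Prop. 4.9.1 (b) p. 55, Lemma 4.9.3 p. 56; §4.3 (4.3.1) p. 43.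
* [Serre1979] J.-P. Serre, *Local Fields*, GTM 67 (1979): Ch. V §3 Prop. 5, Cor. 2–3 (the eigen-field and its completion).
* [Kottwitz1986BaseChangeUnits] R. E. Kottwitz, *Base change for unit elements of Hecke algebras*, Compositio Math. 60 (1986): §1 pp. 240–241.
-/

set_option autoImplicit false

noncomputable section

namespace Summit.HodgeConjecture.HodgeConjecture.Cruxes.H413.F0P3cDyRamCleanSgnDiffTypeTwoOfFrame

open MeasureTheory Measure NumberField IsDedekindDomain Topology Filter Polynomial
open Literature.NumberTheory.Automorphic Literature.NumberTheory.Automorphic.UnitaryGroup Literature.NumberTheory.Automorphic.IntegralReduction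
open Literature.NumberTheory.Rogawski1990 Literature.NumberTheory.GaloisRepresentations Literature.NumberTheory.NumberFields
open Literature.NumberTheory.Automorphic.UnitaryThreeFourFrame
open scoped Matrix MatrixGroups Classical Valued
open Literature.NumberTheory.Automorphic.UnitaryLatticeTree Literature.NumberTheory.Automorphic.HermitianLattice
open Literature.NumberTheory.QuadraticForms
open Summit.HodgeConjecture.HodgeConjecture.Cruxes.H413.F0P3cDyRamToricCensusDefs
open Summit.HodgeConjecture.HodgeConjecture.Cruxes.H413.F0P3cDyRamFourFramePieces
open Summit.HodgeConjecture.HodgeConjecture.Cruxes.H413.F0P3cDyRamFourFrameCensusDefs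
open Summit.HodgeConjecture.HodgeConjecture.Cruxes.H413.F0P3cDyRamStageOneBDefs
open Summit.HodgeConjecture.HodgeConjecture.Cruxes.H413.F0P3cDyRamLevelsTypeTwoCensusLawOfSockets
open Summit.HodgeConjecture.HodgeConjecture.Cruxes.H413

set_option maxHeartbeats 2000000 in
-- budget only: statement-heavy binders (the ≈ 11 k-character frame-level letter and the ≈ 6 k-character literal letter), as ★ FILE C.
/-- **(S4-frame) β₂ AT THE LITERALS ⟸ β₂ AT THE LITERALS GIVEN THE EIGEN-FIELD PACKAGE.**  `hFrame` = `beta2Frame.letter.v1`: for every near-`1` `G`-regular type-(2) `γ_H`, EVERY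
frame package `(E′, c₁, δ, m₀, s, w₁, Θ, α, lam)` carrying ★ `levelsCensus4`'s 18 letters, and every anisotropic literal datum `(P₁, dg, η, γ₁)` with `betaT2lit`'s 10 clauses:
`(T₊ − T−′)(endoGL (ι_w γ_H.1, ι_w γ_H.2)) = (T₊ − T−′)(P₁·endoGL (γ₁, ι_w γ_H.2)·P₁⁻¹)`.  Conclusion = `betaT2lit.letter.v1` (ecb8685d) VERBATIM (= ★ p860931's `hLit` binder).
Proof: ★ FILE C's frame construction, then `hFrame` at the package.  `hFrame` is a HYPOTHESIS — nothing asserted.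
[cite: Rogawski1990, §4.9 Prop. 4.9.1 (b) p. 55, Lemma 4.9.3 p. 56] [cite: Serre1979, Ch. V §3 Prop. 5, Cor. 2–3] [cite: Kottwitz1986BaseChangeUnits, §1 pp. 240–241] -/
theorem hbeta2lit_of_frame
    (hFrame :
      ∀ (L : Type) [Field L] [NumberField L] [IsCMField L]
        {v : HeightOneSpectrum (𝓞 ↥(maximalRealSubfield L))} (w : UnitaryGroup.PlacesOver L v)
        (hw : IsCMField.complexConj L • w.1 = w.1) (_he : v.asIdeal.ramificationIdx' w.1.asIdeal ≠ 1)
        (_h2 : ¬ IsUnit (2 : 𝒪[w.1.adicCompletion L]))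
        (ϖ : (w.1.adicCompletion L)) (_hϖ : Valued.v ϖ = WithZero.exp (-1 : ℤ)) (d tE : ℕ) (_hD : IsRamifiedQuadraticDatum (galAdicCompletionMap (L := L) (IsCMField.complexConj L) hw) ϖ d tE)
        [Fintype (Valued.ResidueField (w.1.adicCompletion L))],
        ∃ V ∈ 𝓝 (1 : ((UnitaryGroup.cmDatum L 2 (Matrix.of fun i j : Fin 2 => if i.val + j.val + 1 = 2 then (1 : L) else 0)).Local v × (UnitaryGroup.cmDatum L 1 (Matrix.of fun i j : Fin 1 => if i.val + j.val + 1 = 1 then (1 : L) else 0)).Local v)), ∀ γH ∈ V, IsLocalGRegular L v γH → ¬ (∃ x : (w.1.adicCompletion L), (((((γH).1.val : GL (Fin 2) (UnitaryGroup.LocalRing L v)).val.map (Pi.evalRingHom (fun w' : UnitaryGroup.PlacesOver L v => w'.1.adicCompletion L) w))).charpoly).IsRoot x) → ∀ (E' : Type) [Field E'] [NumberField E'] [Algebra L E'] [Algebra.IsQuadraticExtension L E'] (c₁ : E' ≃ₐ[L] E') (δ : E') (m₀ : L) (s : (w.1.adicCompletion L)) (w₁ : UnitaryGroup.PlacesOver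 E' w.1) (hw₁ : c₁ • w₁.1 = w₁.1) (Θ : (w₁.1.adicCompletion E') →+* (w₁.1.adicCompletion E')) (α lam : (w₁.1.adicCompletion E')), c₁ ≠ 1 → c₁ δ = -δ → δ ≠ 0 → algebraMap L E' m₀ = δ ^ 2 → s ≠ 0 → (((γH.1.val : GL (Fin 2) (UnitaryGroup.LocalRing L v)).val.map (Pi.evalRingHom (fun w' : UnitaryGroup.PlacesOver L v => w'.1.adicCompletion L) w))).trace * (((γH.1.val : GL (Fin 2) (UnitaryGroup.LocalRing L v)).val.map (Pi.evalRingHom (fun w' : UnitaryGroup.PlacesOver L v => w'.1.adicCompletion L) w))).trace - 4 * (((γH.1.val : GL (Fin 2) (UnitaryGroup.LocalRing L v)).val.map (Pi.evalRingHom (fun w' : UnitaryGroup.PlacesOver L v => w'.1.adicCompletion L) w))).det = s * s * ((m₀ : L) : (w.1.adicCompletion L)) →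
      (((γH.1.val : GL (Fin 2) (UnitaryGroup.LocalRing L v)).val.map (Pi.evalRingHom (fun w' : UnitaryGroup.PlacesOver L v => w'.1.adicCompletion L) w))).det * (galAdicCompletionMap (L := L) (IsCMField.complexConj L) hw) (((γH.1.val : GL (Fin 2) (UnitaryGroup.LocalRing L v)).val.map (Pi.evalRingHom (fun w' : UnitaryGroup.PlacesOver L v => w'.1.adicCompletion L) w))).det = 1 → (((γH.1.val : GL (Fin 2) (UnitaryGroup.LocalRing L v)).val.map (Pi.evalRingHom (fun w' : UnitaryGroup.PlacesOver L v => w'.1.adicCompletion L) w))).trace = (((γH.1.val : GL (Fin 2) (UnitaryGroup.LocalRing L v)).val.map (Pi.evalRingHom (fun w' : UnitaryGroup.PlacesOver L v => w'.1.adicCompletion L) w))).det * (galAdicCompletionMap (L := L) (IsCMField.complexConj L) hw) (((γH.1.val : GL (Fin 2) (UnitaryGroup.LocalRing L v)).val.map (Pi.evalRingHom (fun w' : UnitaryGroup.PlacesOver L v => w'.1.adicCompletion L) w))).trace → (∀ x : (w.1.adicCompletion L), x * x - (((γH.1.val : GL (Fin 2) (UnitaryGroup.LocalRing L v)).val.map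 (Pi.evalRingHom (fun w' : UnitaryGroup.PlacesOver L v => w'.1.adicCompletion L) w))).trace * x + (((γH.1.val : GL (Fin 2) (UnitaryGroup.LocalRing L v)).val.map (Pi.evalRingHom (fun w' : UnitaryGroup.PlacesOver L v => w'.1.adicCompletion L) w))).det ≠ 0) → (∀ z, galAdicCompletionMap (L := E') c₁ hw₁ (galAdicCompletionMap (L := E') c₁ hw₁ z) = z) → (∀ z, Valued.v (galAdicCompletionMap (L := E') c₁ hw₁ z) = Valued.v z) → (∀ a, galAdicCompletionMap (L := E') c₁ hw₁ (toPlace w.1 w₁ a) = toPlace w.1 w₁ a) → (∀ a, Valued.v (toPlace w.1 w₁ a) ≤ 1 ↔ Valued.v a ≤ 1) → (∀ z : (w₁.1.adicCompletion E'), galAdicCompletionMap (L := E') c₁ hw₁ z = z ↔ ∃ a, toPlace w.1 w₁ a = z) → (∀ a, Θ (toPlace w.1 w₁ a) = toPlace w.1 w₁ ((galAdicCompletionMap (L := L) (IsCMField.complexConj L) hw) a)) → (∀ z, Θ (Θ z) = z) →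
      (∀ z, Θ (galAdicCompletionMap (L := E') c₁ hw₁ z) = galAdicCompletionMap (L := E') c₁ hw₁ (Θ z)) → (∀ z, Valued.v (Θ z) = Valued.v z) → galAdicCompletionMap (L := E') c₁ hw₁ α ≠ α → Valued.v α ≤ 1 → (∀ z : (w₁.1.adicCompletion E'), Valued.v z ≤ 1 → Valued.v ((z - galAdicCompletionMap (L := E') c₁ hw₁ z) / (α - galAdicCompletionMap (L := E') c₁ hw₁ α)) ≤ 1) → 2 * lam = toPlace w.1 w₁ (((γH.1.val : GL (Fin 2) (UnitaryGroup.LocalRing L v)).val.map (Pi.evalRingHom (fun w' : UnitaryGroup.PlacesOver L v => w'.1.adicCompletion L) w))).trace + toPlace w.1 w₁ s * ((δ : E') : (w₁.1.adicCompletion E')) → lam * lam = toPlace w.1 w₁ (((γH.1.val : GL (Fin 2) (UnitaryGroup.LocalRing L v)).val.map (Pi.evalRingHom (fun w' : UnitaryGroup.PlacesOver L v => w'.1.adicCompletion L) w))).trace * lam - toPlace w.1 w₁ (((γH.1.val : GL (Fin 2) (UnitaryGroup.LocalRing L v)).val.map (Pi.evalRingHom (fun w' : UnitaryGroup.PlacesOver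 L v => w'.1.adicCompletion L) w))).det → galAdicCompletionMap (L := E') c₁ hw₁ lam = toPlace w.1 w₁ (((γH.1.val : GL (Fin 2) (UnitaryGroup.LocalRing L v)).val.map (Pi.evalRingHom (fun w' : UnitaryGroup.PlacesOver L v => w'.1.adicCompletion L) w))).trace - lam → Θ lam * lam = 1 → Valued.v lam = 1 → (∀ z : (w₁.1.adicCompletion E'), ∃! pq : (w.1.adicCompletion L) × (w.1.adicCompletion L), z = toPlace w.1 w₁ pq.1 + toPlace w.1 w₁ pq.2 * lam) → ∀ (P₁ : GL (Fin 3) (w.1.adicCompletion L)) (dg : Fin 2 → (w.1.adicCompletion L)) (η : (w.1.adicCompletion L)) (γ₁ : GL (Fin 2) (w.1.adicCompletion L)),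
            endoGL (((localNonsplitEquiv (IsCMField.complexConj L) (Matrix.of fun i j : Fin 2 => if i.val + j.val + 1 = 2 then (1 : L) else 0) (IsCMField.complexConj_ne_one L) w hw γH.1 :
              ↥(unitaryGroupOfForm (galAdicCompletionMap (L := L) (IsCMField.complexConj L) hw) (placeForm (Matrix.of fun i j : Fin 2 => if i.val + j.val + 1 = 2 then (1 : L) else 0) w.1))) : GL (Fin 2) (w.1.adicCompletion L)),
            ((localNonsplitEquiv (IsCMField.complexConj L) (Matrix.of fun i j : Fin 1 => if i.val + j.val + 1 = 1 then (1 : L) else 0) (IsCMField.complexConj_ne_one L) w hw γH.2 :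
              ↥(unitaryGroupOfForm (galAdicCompletionMap (L := L) (IsCMField.complexConj L) hw) (placeForm (Matrix.of fun i j : Fin 1 => if i.val + j.val + 1 = 1 then (1 : L) else 0) w.1))) : GL (Fin 1) (w.1.adicCompletion L))) ∈ unitaryGroupOfForm (galAdicCompletionMap (L := L) (IsCMField.complexConj L) hw) (placeForm (Matrix.of fun i j : Fin 3 => if i.val + j.val + 1 = 3 then (1 : L) else 0) w.1) →
            P₁ * endoGL (γ₁, ((localNonsplitEquiv (IsCMField.complexConj L) (Matrix.of fun i j : Fin 1 => if i.val + j.val + 1 = 1 then (1 : L) else 0) (IsCMField.complexConj_ne_one L) w hw γH.2 :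
              ↥(unitaryGroupOfForm (galAdicCompletionMap (L := L) (IsCMField.complexConj L) hw) (placeForm (Matrix.of fun i j : Fin 1 => if i.val + j.val + 1 = 1 then (1 : L) else 0) w.1))) : GL (Fin 1) (w.1.adicCompletion L))) * P₁⁻¹ ∈ unitaryGroupOfForm (galAdicCompletionMap (L := L) (IsCMField.complexConj L) hw) (placeForm (Matrix.of fun i j : Fin 3 => if i.val + j.val + 1 = 3 then (1 : L) else 0) w.1) →
            formCongr (galAdicCompletionMap (L := L) (IsCMField.complexConj L) hw) P₁ (placeForm (Matrix.of fun i j : Fin 3 => if i.val + j.val + 1 = 3 then (1 : L) else 0) w.1) =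
              (!![(Matrix.diagonal dg) 0 0, 0, (Matrix.diagonal dg) 0 1; 0, η, 0; (Matrix.diagonal dg) 1 0, 0, (Matrix.diagonal dg) 1 1] : Matrix (Fin 3) (Fin 3) (w.1.adicCompletion L)) →
            (∀ i, Valued.v (dg i) = 1) → (∀ i, (galAdicCompletionMap (L := L) (IsCMField.complexConj L) hw) (dg i) = dg i) →
            (galAdicCompletionMap (L := L) (IsCMField.complexConj L) hw) η = η → Valued.v η = 1 → (¬ ∃ t : (w.1.adicCompletion L), t * (galAdicCompletionMap (L := L) (IsCMField.complexConj L) hw) t = η) →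
            γ₁ ∈ unitaryGroupOfForm (galAdicCompletionMap (L := L) (IsCMField.complexConj L) hw) (Matrix.diagonal dg) →
            (γ₁ : Matrix (Fin 2) (Fin 2) (w.1.adicCompletion L)).charpoly = (((((γH).1.val : GL (Fin 2) (UnitaryGroup.LocalRing L v)).val.map (Pi.evalRingHom (fun w' : UnitaryGroup.PlacesOver L v => w'.1.adicCompletion L) w)))).charpoly →
          (transvPlusFixCount (galAdicCompletionMap (L := L) (IsCMField.complexConj L) hw) ϖ d (d % 2) (mstarOfRecord d) (endoGL (((localNonsplitEquiv (IsCMField.complexConj L) (Matrix.of fun i j : Fin 2 => if i.val + j.val + 1 = 2 then (1 : L) else 0) (IsCMField.complexConj_ne_one L) w hw γH.1 :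
              ↥(unitaryGroupOfForm (galAdicCompletionMap (L := L) (IsCMField.complexConj L) hw) (placeForm (Matrix.of fun i j : Fin 2 => if i.val + j.val + 1 = 2 then (1 : L) else 0) w.1))) : GL (Fin 2) (w.1.adicCompletion L)),
            ((localNonsplitEquiv (IsCMField.complexConj L) (Matrix.of fun i j : Fin 1 => if i.val + j.val + 1 = 1 then (1 : L) else 0) (IsCMField.complexConj_ne_one L) w hw γH.2 :
              ↥(unitaryGroupOfForm (galAdicCompletionMap (L := L) (IsCMField.complexConj L) hw) (placeForm (Matrix.of fun i j : Fin 1 => if i.val + j.val + 1 = 1 then (1 : L) else 0) w.1))) : GL (Fin 1) (w.1.adicCompletion L)))) : ℤ) -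
            (cleanMinusFixCount (galAdicCompletionMap (L := L) (IsCMField.complexConj L) hw) ϖ d (d % 2) (mstarOfRecord d) (mcOfRecord d) (endoGL (((localNonsplitEquiv (IsCMField.complexConj L) (Matrix.of fun i j : Fin 2 => if i.val + j.val + 1 = 2 then (1 : L) else 0) (IsCMField.complexConj_ne_one L) w hw γH.1 :
              ↥(unitaryGroupOfForm (galAdicCompletionMap (L := L) (IsCMField.complexConj L) hw) (placeForm (Matrix.of fun i j : Fin 2 => if i.val + j.val + 1 = 2 then (1 : L) else 0) w.1))) : GL (Fin 2) (w.1.adicCompletion L)),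
            ((localNonsplitEquiv (IsCMField.complexConj L) (Matrix.of fun i j : Fin 1 => if i.val + j.val + 1 = 1 then (1 : L) else 0) (IsCMField.complexConj_ne_one L) w hw γH.2 :
              ↥(unitaryGroupOfForm (galAdicCompletionMap (L := L) (IsCMField.complexConj L) hw) (placeForm (Matrix.of fun i j : Fin 1 => if i.val + j.val + 1 = 1 then (1 : L) else 0) w.1))) : GL (Fin 1) (w.1.adicCompletion L)))) : ℤ) =
          (transvPlusFixCount (galAdicCompletionMap (L := L) (IsCMField.complexConj L) hw) ϖ d (d % 2) (mstarOfRecord d) (P₁ * endoGL (γ₁, ((localNonsplitEquiv (IsCMField.complexConj L) (Matrix.of fun i j : Fin 1 => if i.val + j.val + 1 = 1 then (1 : L) else 0) (IsCMField.complexConj_ne_one L) w hw γH.2 :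
              ↥(unitaryGroupOfForm (galAdicCompletionMap (L := L) (IsCMField.complexConj L) hw) (placeForm (Matrix.of fun i j : Fin 1 => if i.val + j.val + 1 = 1 then (1 : L) else 0) w.1))) : GL (Fin 1) (w.1.adicCompletion L))) * P₁⁻¹) : ℤ) -
            (cleanMinusFixCount (galAdicCompletionMap (L := L) (IsCMField.complexConj L) hw) ϖ d (d % 2) (mstarOfRecord d) (mcOfRecord d) (P₁ * endoGL (γ₁, ((localNonsplitEquiv (IsCMField.complexConj L) (Matrix.of fun i j : Fin 1 => if i.val + j.val + 1 = 1 then (1 : L) else 0) (IsCMField.complexConj_ne_one L) w hw γH.2 :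
              ↥(unitaryGroupOfForm (galAdicCompletionMap (L := L) (IsCMField.complexConj L) hw) (placeForm (Matrix.of fun i j : Fin 1 => if i.val + j.val + 1 = 1 then (1 : L) else 0) w.1))) : GL (Fin 1) (w.1.adicCompletion L))) * P₁⁻¹) : ℤ)) :
      ∀ (L : Type) [Field L] [NumberField L] [IsCMField L]
        {v : HeightOneSpectrum (𝓞 ↥(maximalRealSubfield L))} (w : UnitaryGroup.PlacesOver L v)
        (hw : IsCMField.complexConj L • w.1 = w.1) (_he : v.asIdeal.ramificationIdx' w.1.asIdeal ≠ 1)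
        (_h2 : ¬ IsUnit (2 : 𝒪[w.1.adicCompletion L]))
        (ϖ : (w.1.adicCompletion L)) (_hϖ : Valued.v ϖ = WithZero.exp (-1 : ℤ)) (d tE : ℕ) (_hD : IsRamifiedQuadraticDatum (galAdicCompletionMap (L := L) (IsCMField.complexConj L) hw) ϖ d tE)
        [Fintype (Valued.ResidueField (w.1.adicCompletion L))],
        ∃ V ∈ 𝓝 (1 : ((UnitaryGroup.cmDatum L 2 (Matrix.of fun i j : Fin 2 => if i.val + j.val + 1 = 2 then (1 : L) else 0)).Local v × (UnitaryGroup.cmDatum L 1 (Matrix.of fun i j : Fin 1 => if i.val + j.val + 1 = 1 then (1 : L) else 0)).Local v)), ∀ γH ∈ V, IsLocalGRegular L v γH →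
          ¬ (∃ x : (w.1.adicCompletion L), ((((((γH).1.val : GL (Fin 2) (UnitaryGroup.LocalRing L v)).val.map (Pi.evalRingHom (fun w' : UnitaryGroup.PlacesOver L v => w'.1.adicCompletion L) w)))).charpoly).IsRoot x) →
          ∀ (P₁ : GL (Fin 3) (w.1.adicCompletion L)) (dg : Fin 2 → (w.1.adicCompletion L)) (η : (w.1.adicCompletion L)) (γ₁ : GL (Fin 2) (w.1.adicCompletion L)),
            endoGL (((localNonsplitEquiv (IsCMField.complexConj L) (Matrix.of fun i j : Fin 2 => if i.val + j.val + 1 = 2 then (1 : L) else 0) (IsCMField.complexConj_ne_one L) w hw γH.1 :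
              ↥(unitaryGroupOfForm (galAdicCompletionMap (L := L) (IsCMField.complexConj L) hw) (placeForm (Matrix.of fun i j : Fin 2 => if i.val + j.val + 1 = 2 then (1 : L) else 0) w.1))) : GL (Fin 2) (w.1.adicCompletion L)),
            ((localNonsplitEquiv (IsCMField.complexConj L) (Matrix.of fun i j : Fin 1 => if i.val + j.val + 1 = 1 then (1 : L) else 0) (IsCMField.complexConj_ne_one L) w hw γH.2 :
              ↥(unitaryGroupOfForm (galAdicCompletionMap (L := L) (IsCMField.complexConj L) hw) (placeForm (Matrix.of fun i j : Fin 1 => if i.val + j.val + 1 = 1 then (1 : L) else 0) w.1))) : GL (Fin 1) (w.1.adicCompletion L))) ∈ unitaryGroupOfForm (galAdicCompletionMap (L := L) (IsCMField.complexConj L) hw) (placeForm (Matrix.of fun i j : Fin 3 => if i.val + j.val + 1 = 3 then (1 : L) else 0) w.1) →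
            P₁ * endoGL (γ₁, ((localNonsplitEquiv (IsCMField.complexConj L) (Matrix.of fun i j : Fin 1 => if i.val + j.val + 1 = 1 then (1 : L) else 0) (IsCMField.complexConj_ne_one L) w hw γH.2 :
              ↥(unitaryGroupOfForm (galAdicCompletionMap (L := L) (IsCMField.complexConj L) hw) (placeForm (Matrix.of fun i j : Fin 1 => if i.val + j.val + 1 = 1 then (1 : L) else 0) w.1))) : GL (Fin 1) (w.1.adicCompletion L))) * P₁⁻¹ ∈ unitaryGroupOfForm (galAdicCompletionMap (L := L) (IsCMField.complexConj L) hw) (placeForm (Matrix.of fun i j : Fin 3 => if i.val + j.val + 1 = 3 then (1 : L) else 0) w.1) →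
            formCongr (galAdicCompletionMap (L := L) (IsCMField.complexConj L) hw) P₁ (placeForm (Matrix.of fun i j : Fin 3 => if i.val + j.val + 1 = 3 then (1 : L) else 0) w.1) =
              (!![(Matrix.diagonal dg) 0 0, 0, (Matrix.diagonal dg) 0 1; 0, η, 0; (Matrix.diagonal dg) 1 0, 0, (Matrix.diagonal dg) 1 1] : Matrix (Fin 3) (Fin 3) (w.1.adicCompletion L)) →
            (∀ i, Valued.v (dg i) = 1) → (∀ i, (galAdicCompletionMap (L := L) (IsCMField.complexConj L) hw) (dg i) = dg i) →
            (galAdicCompletionMap (L := L) (IsCMField.complexConj L) hw) η = η → Valued.v η = 1 → (¬ ∃ t : (w.1.adicCompletion L), t * (galAdicCompletionMap (L := L) (IsCMField.complexConj L) hw) t = η) →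
            γ₁ ∈ unitaryGroupOfForm (galAdicCompletionMap (L := L) (IsCMField.complexConj L) hw) (Matrix.diagonal dg) →
            (γ₁ : Matrix (Fin 2) (Fin 2) (w.1.adicCompletion L)).charpoly = (((((γH).1.val : GL (Fin 2) (UnitaryGroup.LocalRing L v)).val.map (Pi.evalRingHom (fun w' : UnitaryGroup.PlacesOver L v => w'.1.adicCompletion L) w)))).charpoly →
          (transvPlusFixCount (galAdicCompletionMap (L := L) (IsCMField.complexConj L) hw) ϖ d (d % 2) (mstarOfRecord d) (endoGL (((localNonsplitEquiv (IsCMField.complexConj L) (Matrix.of fun i j : Fin 2 => if i.val + j.val + 1 = 2 then (1 : L) else 0) (IsCMField.complexConj_ne_one L) w hw γH.1 :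
              ↥(unitaryGroupOfForm (galAdicCompletionMap (L := L) (IsCMField.complexConj L) hw) (placeForm (Matrix.of fun i j : Fin 2 => if i.val + j.val + 1 = 2 then (1 : L) else 0) w.1))) : GL (Fin 2) (w.1.adicCompletion L)),
            ((localNonsplitEquiv (IsCMField.complexConj L) (Matrix.of fun i j : Fin 1 => if i.val + j.val + 1 = 1 then (1 : L) else 0) (IsCMField.complexConj_ne_one L) w hw γH.2 :
              ↥(unitaryGroupOfForm (galAdicCompletionMap (L := L) (IsCMField.complexConj L) hw) (placeForm (Matrix.of fun i j : Fin 1 => if i.val + j.val + 1 = 1 then (1 : L) else 0) w.1))) : GL (Fin 1) (w.1.adicCompletion L)))) : ℤ) -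
            (cleanMinusFixCount (galAdicCompletionMap (L := L) (IsCMField.complexConj L) hw) ϖ d (d % 2) (mstarOfRecord d) (mcOfRecord d) (endoGL (((localNonsplitEquiv (IsCMField.complexConj L) (Matrix.of fun i j : Fin 2 => if i.val + j.val + 1 = 2 then (1 : L) else 0) (IsCMField.complexConj_ne_one L) w hw γH.1 :
              ↥(unitaryGroupOfForm (galAdicCompletionMap (L := L) (IsCMField.complexConj L) hw) (placeForm (Matrix.of fun i j : Fin 2 => if i.val + j.val + 1 = 2 then (1 : L) else 0) w.1))) : GL (Fin 2) (w.1.adicCompletion L)),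
            ((localNonsplitEquiv (IsCMField.complexConj L) (Matrix.of fun i j : Fin 1 => if i.val + j.val + 1 = 1 then (1 : L) else 0) (IsCMField.complexConj_ne_one L) w hw γH.2 :
              ↥(unitaryGroupOfForm (galAdicCompletionMap (L := L) (IsCMField.complexConj L) hw) (placeForm (Matrix.of fun i j : Fin 1 => if i.val + j.val + 1 = 1 then (1 : L) else 0) w.1))) : GL (Fin 1) (w.1.adicCompletion L)))) : ℤ) =
          (transvPlusFixCount (galAdicCompletionMap (L := L) (IsCMField.complexConj L) hw) ϖ d (d % 2) (mstarOfRecord d) (P₁ * endoGL (γ₁, ((localNonsplitEquiv (IsCMField.complexConj L) (Matrix.of fun i j : Fin 1 => if i.val + j.val + 1 = 1 then (1 : L) else 0) (IsCMField.complexConj_ne_one L) w hw γH.2 :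
              ↥(unitaryGroupOfForm (galAdicCompletionMap (L := L) (IsCMField.complexConj L) hw) (placeForm (Matrix.of fun i j : Fin 1 => if i.val + j.val + 1 = 1 then (1 : L) else 0) w.1))) : GL (Fin 1) (w.1.adicCompletion L))) * P₁⁻¹) : ℤ) -
            (cleanMinusFixCount (galAdicCompletionMap (L := L) (IsCMField.complexConj L) hw) ϖ d (d % 2) (mstarOfRecord d) (mcOfRecord d) (P₁ * endoGL (γ₁, ((localNonsplitEquiv (IsCMField.complexConj L) (Matrix.of fun i j : Fin 1 => if i.val + j.val + 1 = 1 then (1 : L) else 0) (IsCMField.complexConj_ne_one L) w hw γH.2 :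
              ↥(unitaryGroupOfForm (galAdicCompletionMap (L := L) (IsCMField.complexConj L) hw) (placeForm (Matrix.of fun i j : Fin 1 => if i.val + j.val + 1 = 1 then (1 : L) else 0) w.1))) : GL (Fin 1) (w.1.adicCompletion L))) * P₁⁻¹) : ℤ) := by
  intro L _ _ _ v w hw he h2 ϖ hϖ d tE hD _
  classical
  haveI : Algebra.IsQuadraticExtension ↥(maximalRealSubfield L) L := IsCMField.isQuadraticExtension L
  haveI : CharZero (w.1.adicCompletion L) := charZero_of_injective_algebraMap (algebraMap L (w.1.adicCompletion L)).injective
  have hc1 : IsCMField.complexConj L ≠ 1 := IsCMField.complexConj_ne_one L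
  obtain ⟨VF, hVF, hF⟩ := hFrame L w hw he h2 ϖ hϖ d tE hD
  refine ⟨VF, hVF, fun γH hγ hreg hirr P₁ dg η γ₁ hU1 hU2 hA2 hA3 hA4 hA7 hA8 hA9 hA10 hA12 => ?_⟩
  -- the one-place matrix `g_w` of `γ_H.1`, its trace `t` and determinant `D`; `σ := σ_w` (★ FILE C, token for token)
  set σ : (w.1.adicCompletion L) →+* (w.1.adicCompletion L) := (galAdicCompletionMap (L := L) (IsCMField.complexConj L) hw) with hσdef
  set g : Matrix (Fin 2) (Fin 2) (w.1.adicCompletion L) := ((γH.1.val : GL (Fin 2) (UnitaryGroup.LocalRing L v)).val.map (Pi.evalRingHom (fun w' : UnitaryGroup.PlacesOver L v => w'.1.adicCompletion L) w)) with hgdef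
  have hσσ : ∀ a, σ (σ a) = a := galAdicCompletionMap_galAdicCompletionMap_of_smul_eq (IsCMField.complexConj L) w hc1 hw
  have hσv : ∀ a, Valued.v (σ a) = Valued.v a := fun a => valued_galAdicCompletionMap (L := L) (IsCMField.complexConj L) hw a
  -- `g_w` is unitary for `Φ₂,w = antidiag(1,1)` ⇒ `D·σD = 1`, `t = D·σt`
  have hgunit : (g.map σ)ᵀ * (!![0, 1; 1, 0] : Matrix (Fin 2) (Fin 2) (w.1.adicCompletion L)) * g = !![0, 1; 1, 0] := by
    have h := transpose_map_fst_evalRingHom_mul L v w hw γH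
    rw [UnitaryGroup.placeForm_antidiagTwo_eq_antidiag L v w] at h
    exact h
  have hDσ : g.det * σ g.det = 1 := det_mul_map_det_eq_one_of_unitary_antidiag σ g hgunit
  have hσt : σ g.trace = g.trace * σ g.det := by
    have h := map_trace_mul_det_eq_trace_of_unitary_antidiag σ g hgunit
    calc σ g.trace = σ g.trace * (g.det * σ g.det) := by rw [hDσ, mul_one]
      _ = σ g.trace * g.det * σ g.det := by ring
      _ = g.trace * σ g.det := by rw [h]
  have htσ : g.trace = g.det * σ g.trace := by
    calc g.trace = g.trace * (g.det * σ g.det) := by rw [hDσ, mul_one]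
      _ = g.det * (g.trace * σ g.det) := by ring
      _ = g.det * σ g.trace := by rw [← hσt]
  -- type (2): `χ_g(x) = x² − t·x + D ≠ 0` for every `x ∈ L_w`
  have hirr' : ∀ x : (w.1.adicCompletion L), x * x - g.trace * x + g.det ≠ 0 := by
    intro x hx
    apply hirr
    refine ⟨x, ?_⟩
    rw [Matrix.charpoly_fin_two, Polynomial.IsRoot.def]
    simp only [eval_add, eval_sub, eval_pow, eval_X, eval_mul, eval_C]
    linear_combination hx
  -- `Δ := t² − 4D ≠ 0` (else `t∕2` is a root)
  have h20 : (2 : (w.1.adicCompletion L)) ≠ 0 := two_ne_zero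
  have hΔ0 : g.trace * g.trace - 4 * g.det ≠ 0 := by
    intro h0
    apply hirr' (g.trace / 2)
    have e : g.trace / 2 * (g.trace / 2) - g.trace * (g.trace / 2) + g.det = -(g.trace * g.trace - 4 * g.det) / 4 := by ring
    rw [e, h0, neg_zero, zero_div]
  -- a global representative `m₀` of the square class of `Δ`, and `E′ = L(√m₀)`
  obtain ⟨m₀, hm₀0, r, hr⟩ := exists_isSquare_inv_mul_coe_of_ne_zero w.1 hΔ0
  have hm₀E : algebraMap L (w.1.adicCompletion L) m₀ ≠ 0 := (_root_.map_ne_zero (algebraMap L (w.1.adicCompletion L))).2 hm₀0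
  have hr0 : r ≠ 0 := by
    intro h0
    rw [h0, mul_zero] at hr
    exact mul_ne_zero (inv_ne_zero hΔ0) hm₀E hr
  have hΔ : g.trace * g.trace - 4 * g.det = r⁻¹ * r⁻¹ * ((m₀ : L) : (w.1.adicCompletion L)) := by
    have h1 : algebraMap L (w.1.adicCompletion L) m₀ = (g.trace * g.trace - 4 * g.det) * (r * r) := by
      rw [← hr, ← mul_assoc, mul_inv_cancel₀ hΔ0, one_mul]
    have h2' : ((m₀ : L) : (w.1.adicCompletion L)) = algebraMap L (w.1.adicCompletion L) m₀ := rfl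
    rw [h2', h1]
    field_simp
  have hns : ¬ IsSquare (algebraMap L (w.1.adicCompletion L) m₀) := by
    rintro ⟨b, hb⟩
    have h2' : ((m₀ : L) : (w.1.adicCompletion L)) = algebraMap L (w.1.adicCompletion L) m₀ := rfl
    rw [h2', hb] at hΔ
    apply hirr' ((g.trace + r⁻¹ * b) / 2)
    have e : (g.trace + r⁻¹ * b) / 2 * ((g.trace + r⁻¹ * b) / 2) - g.trace * ((g.trace + r⁻¹ * b) / 2) + g.det =
        (r⁻¹ * r⁻¹ * (b * b) - (g.trace * g.trace - 4 * g.det)) / 4 := by ring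
    rw [e, ← hΔ, sub_self, zero_div]
  have hnsq : ¬ IsSquare m₀ := not_isSquare_of_not_isSquare_algebraMap m₀ hns
  haveI : Fact (Irreducible (X ^ 2 - C m₀ : L[X])) := ⟨irreducible_X_sq_sub_C_of_not_isSquare m₀ hnsq⟩
  haveI : NumberField (AdjoinRoot (X ^ 2 - C m₀ : L[X])) := numberField_adjoinRoot m₀
  haveI : Algebra.IsQuadraticExtension L (AdjoinRoot (X ^ 2 - C m₀ : L[X])) := isQuadraticExtension_adjoinRoot m₀
  obtain ⟨c₁, hc₁, hc₁1⟩ := exists_algEquiv_root_eq_neg m₀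
  have hδ0 : AdjoinRoot.root (X ^ 2 - C m₀ : L[X]) ≠ 0 := root_X_sq_sub_C_ne_zero m₀
  have hmδ : algebraMap L (AdjoinRoot (X ^ 2 - C m₀ : L[X])) m₀ = (AdjoinRoot.root (X ^ 2 - C m₀ : L[X])) ^ 2 := (root_X_sq_sub_C_sq m₀).symm
  -- the eigen-package (★ p857432) and the frame letter
  obtain ⟨w₁, hw₁, Θ, α, lam, hP1, hP2, hP3, hP4, hP5, hP6, hP7, hP8, hP9, hP10, hP11, hP12, hP13, hP14, hP15, hP16, hP17, hP18⟩ :=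
    F0P3cDyRamEigenFieldPackageTypeTwo.exists_eigenPackage (AdjoinRoot (X ^ 2 - C m₀ : L[X])) w.1 c₁ hc₁1 hc₁ hδ0 hmδ σ hσσ hσv (inv_ne_zero hr0) hΔ hDσ htσ hirr'
  exact hF γH hγ hreg hirr (AdjoinRoot (X ^ 2 - C m₀ : L[X])) c₁ (AdjoinRoot.root (X ^ 2 - C m₀ : L[X])) m₀ r⁻¹ w₁ hw₁ Θ α lam hc₁1 hc₁ hδ0 hmδ (inv_ne_zero hr0) hΔ hDσ htσ hirr'
    hP1 hP2 hP3 hP4 hP5 hP6 hP7 hP8 hP9 hP10 hP11 hP12 hP13 hP14 hP15 hP16 hP17 hP18 P₁ dg η γ₁ hU1 hU2 hA2 hA3 hA4 hA7 hA8 hA9 hA10 hA12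

end Summit.HodgeConjecture.HodgeConjecture.Cruxes.H413.F0P3cDyRamCleanSgnDiffTypeTwoOfFrame

end
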